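import Summits.PneNP.PneNP.Theorems.SfmBlMachineTraceFn
import Summits.PneNP.PneNP.Theorems.SfmBlMachineDegree

/-!
# Line «sfm-bl», MACHINE LAYER: cap bounds for the remainder-leg walk enumerations (stmt-PneNP-20523)

FRONTIER F-N1c; nothing here bears on P vs NP.

The capped folds of the machine (`walksC`, `aseqsC`) are the true enumerations as soon as the (unary) cap exceeds
the true counts (`walksC_eq_walksU`, `aseqsC_eq_aseqsU`).  `SfmBlMachineDegree.length_walksU_pieceLegs_le` gives
the count for walks; here the companion for the ALTERNATING LEG-SEQUENCES of M3 over the remainder legs of any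
label list: the remainder legs form a sublist of the pieced legs (`rlegs_sublist`), so every left/right fibre of
them has `≤ L` legs (`length_filter_rlegs_labL_le` / `…labR_le`) and `#aseqsU ≤ 3m·L^t`
(`length_aseqsU_rlegs_le`) — the cap the §6 glue hands to `aseqsC` / `traceSum`.
-/

set_option linter.dupNamespace false -- `Summit.PneNP.PneNP.…`: summit = sub-problem name (D-0017 single-conjunct layout)

namespace Summit.PneNP.PneNP.Theorems.SfmBlMachine

open Literature.Computability.Complexity

/-- The remainder legs are a sublist of the pieced legs. -/
theorem rlegs_sublist (plegs : List PLeg) (labels : List ℕ) : List.Sublist (rlegs plegs labels) plegs := by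
  unfold rlegs
  exact ((List.filter_sublist).map Prod.snd).trans (map_snd_zip_sublist labels plegs)

/-- Hence at most `3m` remainder legs. -/
theorem length_rlegs_le (plegs : List PLeg) (labels : List ℕ) : (rlegs plegs labels).length ≤ plegs.length :=
  (rlegs_sublist plegs labels).length_le

/-- Every left fibre of the remainder legs of the block-split instance has at most `L` legs. -/
theorem length_filter_rlegs_labL_le {L : ℕ} (hL : 0 < L) (trips : List (ℕ × ℕ × ℕ)) (labels : List ℕ) (P : Lab) :
    ((rlegs (pieceLegs L trips) labels).filter fun y => labL y = P).length ≤ L := by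
  refine (((rlegs_sublist _ labels).filter _).length_le).trans ?_
  have := length_nbrs_pieceLegs_le hL trips P
  unfold nbrs at this
  rw [List.length_append, List.length_map, List.length_map] at this
  omega

/-- Every right fibre of the remainder legs of the block-split instance has at most `L` legs. -/
theorem length_filter_rlegs_labR_le {L : ℕ} (hL : 0 < L) (trips : List (ℕ × ℕ × ℕ)) (labels : List ℕ) (P : Lab) :
    ((rlegs (pieceLegs L trips) labels).filter fun y => labR y = P).length ≤ L := by
  refine (((rlegs_sublist _ labels).filter _).length_le).trans ?_
  have := length_nbrs_pieceLegs_le hL trips P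
  unfold nbrs at this
  rw [List.length_append, List.length_map, List.length_map] at this
  omega

/-- **The count of alternating leg-sequences over the remainder legs**: `≤ 3m · L^t` (the cap for `aseqsC`). -/
theorem length_aseqsU_rlegs_le {L : ℕ} (hL : 0 < L) (trips : List (ℕ × ℕ × ℕ)) (labels : List ℕ) (t : ℕ) :
    (aseqsU (rlegs (pieceLegs L trips) labels) t).length ≤ 3 * trips.length * L ^ t := by
  refine (length_aseqsU_le _ (length_filter_rlegs_labL_le hL trips labels) (length_filter_rlegs_labR_le hL trips labels)
    t).trans ?_
  refine Nat.mul_le_mul_right _ ((length_rlegs_le _ labels).trans ?_)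
  rw [length_pieceLegs]

end Summit.PneNP.PneNP.Theorems.SfmBlMachine
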